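import Literature.AlgebraicGeometry.Frobenioids.ArithmeticRealificationInstance
import Literature.AlgebraicGeometry.Frobenioids.ArithmeticRealificationPicCone
import Literature.AlgebraicGeometry.Frobenioids.ArithmeticRealificationPicPull
import Literature.AlgebraicGeometry.Frobenioids.MotivatingExamplesSub
import Literature.AlgebraicGeometry.Frobenioids.FinSubextCatDegreeInvariance
import HarnessLib

/-!
# Frobenioids I, Thm. 6.4 (i)/(ii): `δ_A` of THE `ArithRealification` of `C_{K/F}` — values on generators, the
# non-negative cone, and scaling under pull-back

Mochizuki, *The geometry of Frobenioids I*, Kyushu J. Math. **62** (2008), Thm. 6.4 (i) p. 114 ("`deg^arith_L` determines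
an isomorphism of groups `δ_A : Pic_Φ(A) ⥲ ℝ`"), Ex. 6.3 pp. 113–114 (`deg^arith_L`: the logarithm of the cardinality
of `O_v/(λ)` at a nonarchimedean prime, `-[L_v:ℝ] · log(λ)` at an archimedean one), Thm. 6.4 (ii) p. 114 and its proof
p. 115 – p. 116 (the "order structure" on `Pic_Φ(A)` via `δ_A`; "is equal to `deg(Ψ^rlf) · δ_{A₁}`", ONE factor for
all Frobenius-trivial objects)
[cite: MochizukiFrdI2008, Thm. 6.4 (i) p.114] [cite: MochizukiFrdI2008, Ex. 6.3 p.113]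
[cite: MochizukiFrdI2008, Thm. 6.4 (ii) p.115].

PROOF-ONLY (cell abc-iut; L1-lead R112 (1) row **E4 «δ at THE instance»**; seat abc-iut-L1-d2).  The δ-generic
theorems of `ArithmeticRealificationPicCone.lean` / `ArithmeticRealificationPicPull.lean` read at THE instance
`arithRealification hΦ` (`ArithmeticRealificationInstance.lean`), in the letter of abc-iut-L1-t3's schema
`ArithRealification` (`R.Pic A`, `R.δ A hA`) — the form consumed by abc-iut-w4-d086's
`Thm64ii_L02_orderCompat_of_cones/_of_monoidIso` (E1) and the scaled-naturality form of T64ii/L04 (E2):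
* `arithRealification_δ_ofMul_mk_of` — `δ_A [a] = d_L(a) ≥ 0` for `a ∈ Φ(L)^rlf`, `L = Base A`;
* `arithRealification_δ_single_inr/_inl` — on the generator classes: `δ_A [ι δ_w] = log N(w)` at a finite `w`,
  `= [L_w:ℝ]` at an archimedean `w` (input `hgen` of abc-iut-L1-d7's `Thm64iv_of_transport`);
* **`arithRealification_δ_nonneg_iff`** — `0 ≤ δ_A x ↔ x` is the class of an element of `Φ(L)^rlf` (the cone);
* **`arithRealification_δ_picPull`** — `δ_A (Pic(f) x) = [L_A : L_B] · δ_B x` for `f : Base A ⟶ Base B`;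
* `arithRealification_picPull_bijective` — hence `Pic(f) : Pic_Φ(Base B) → Pic_Φ(Base A)` is BIJECTIVE (both `δ`'s
  are, and `[L_A : L_B] ≥ 1` — abc-iut-L1-t12's `FinSubextCat.finrank_eq_finrank_mul_finrank_along`), so along base
  morphisms the `Pic_Φ` of Frobenius-trivial objects are linked by ISOMORPHISMS scaling `δ` by natural numbers — the
  transports `τ` of abc-iut-w5-d137's `Thm64ii_L04_uniform_of_scaledNaturality` (E2).
-/

noncomputable section

open scoped NNReal

namespace Literature.AlgebraicGeometry.Frobenioids

open CategoryTheory Opposite Function NumberField Literature.AnabelianGeometry.EtaleTheta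

section InstanceDelta

variable {F : Type} [Field F] [NumberField F] {K : Type} [Field K] [Algebra F K]
  (hΦ : PreFrobenioid.IsPerfFactorialOn (arithDivisorFunctor F K))
  (A : PreFrobenioid.rlf (ModelFrobenioid.toElem (arithDivisorFunctor F K) (unitsFunctor F K) (divNatTrans F K)) hΦ)
  (hA : (arithRealification hΦ).ops.IsFrobeniusTrivial A)

/-- **`δ_A [a] = d_L(a)`** for `a ∈ Φ(L)^rlf`, `L = Base A` (THE degree `ArithRlfPic.rlfDegree` read in `ℝ`); in
particular `δ_A [a] ≥ 0`. [cite: MochizukiFrdI2008, Thm. 6.4 (i) p.114] -/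
theorem arithRealification_δ_ofMul_mk_of (a : (PreFrobenioid.IsPerfFactorialOn.op hΦ (op A.base)).Rlf) :
    (arithRealification hΦ).δ A hA (Additive.ofMul (QuotientGroup.mk' _ (Algebra.GrothendieckGroup.of a))) =
      ((Multiplicative.toAdd (ArithRlfPic.rlfDegree hΦ A.base a) : ℝ≥0) : ℝ) := by
  show Multiplicative.toAdd (ArithRlfPic.picDegree hΦ A.base (QuotientGroup.mk' _ (Algebra.GrothendieckGroup.of a))) = _
  rw [ArithRlfPic.arith_picDegree_mk_of hΦ A.base (ArithRlfPic.rlfDegree hΦ A.base) (ArithRlfPic.picDegree hΦ A.base)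
    (ArithRlfPic.picDegree_comp_mk' hΦ A.base), toAdd_ofAdd]

/-- `δ_A [a] ≥ 0` for `a ∈ Φ(L)^rlf`. [cite: MochizukiFrdI2008, Thm. 6.4 (ii) p.115] -/
theorem arithRealification_δ_ofMul_mk_of_nonneg (a : (PreFrobenioid.IsPerfFactorialOn.op hΦ (op A.base)).Rlf) :
    0 ≤ (arithRealification hΦ).δ A hA (Additive.ofMul (QuotientGroup.mk' _ (Algebra.GrothendieckGroup.of a))) := by
  rw [arithRealification_δ_ofMul_mk_of]
  exact NNReal.coe_nonneg _

/-- **`δ_A` on the generator class of a finite place `w`**: `δ_A [ι δ_w] = log N(w)` (`deg^arith_L` of the prime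
divisor at `w` = `log #(O_w/𝔪_w)`, Ex. 6.3 p. 114). [cite: MochizukiFrdI2008, Ex. 6.3 p.113] -/
theorem arithRealification_δ_single_inr (w : FinitePlace A.base.L) :
    (arithRealification hΦ).δ A hA (Additive.ofMul (QuotientGroup.mk' _ (Algebra.GrothendieckGroup.of
      ((PreFrobenioid.IsPerfFactorialOn.op hΦ (op A.base)).toRealification
        (Perfection.of _ (Multiplicative.ofAdd (EffArithDivisor.single A.base.L (Sum.inr w)))))))) =
      Real.log (Ideal.absNorm w.maximalIdeal.asIdeal : ℝ) := by
  rw [arithRealification_δ_mk_iota]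
  have h : EffArithDivisor.toArithDivisor A.base.L (EffArithDivisor.single A.base.L (Sum.inr w)) =
      (Finsupp.single w 1, 0) := by
    classical
    refine Prod.ext (Finsupp.ext fun w' => ?_) (funext fun w' => ?_)
    · rw [EffArithDivisor.toArithDivisor_fst]
      show ((Finsupp.single w (1 : ℕ) w' : ℕ) : ℤ) = Finsupp.single w (1 : ℤ) w'
      rw [Finsupp.single_apply, Finsupp.single_apply]
      split_ifs <;> simp
    · rw [EffArithDivisor.toArithDivisor_snd]
      rfl
  rw [h, arithDegree_single, Int.cast_one, one_mul]

/-- The same in the letter of abc-iut-L1-t1's `logNorm` (sub-DAG `MotivatingExamplesSub`): `δ_A [ι δ_w] = logNorm w` —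
the generator reading `hgen` of abc-iut-L1-d7's `Thm64iv_of_transport`. [cite: MochizukiFrdI2008, Ex. 6.3 p.114] -/
theorem arithRealification_δ_single_inr_logNorm (w : FinitePlace A.base.L) :
    (arithRealification hΦ).δ A hA (Additive.ofMul (QuotientGroup.mk' _ (Algebra.GrothendieckGroup.of
      ((PreFrobenioid.IsPerfFactorialOn.op hΦ (op A.base)).toRealification
        (Perfection.of _ (Multiplicative.ofAdd (EffArithDivisor.single A.base.L (Sum.inr w)))))))) = logNorm w :=
  arithRealification_δ_single_inr hΦ A hA w

/-- **`δ_A` on the class of the archimedean unit divisor at `w`**: `δ_A [ι e_w] = [L_w : ℝ]` (`deg^arith_L` weights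
the archimedean coordinate `t_w = 1` by `[L_w:ℝ]`, Ex. 6.3 p. 113). [cite: MochizukiFrdI2008, Ex. 6.3 p.113] -/
theorem arithRealification_δ_single_inl (w : InfinitePlace A.base.L) :
    (arithRealification hΦ).δ A hA (Additive.ofMul (QuotientGroup.mk' _ (Algebra.GrothendieckGroup.of
      ((PreFrobenioid.IsPerfFactorialOn.op hΦ (op A.base)).toRealification
        (Perfection.of _ (Multiplicative.ofAdd (EffArithDivisor.single A.base.L (Sum.inl w)))))))) =
      (w.mult : ℝ) := by
  classical
  rw [arithRealification_δ_mk_iota, arithDegree_apply]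
  have h1 : (EffArithDivisor.toArithDivisor A.base.L (EffArithDivisor.single A.base.L (Sum.inl w))).1 = 0 := by
    ext w'
    rw [EffArithDivisor.toArithDivisor_fst]
    rfl
  rw [h1, Finsupp.sum_zero_index, zero_add, Finset.sum_eq_single w]
  · rw [EffArithDivisor.toArithDivisor_snd]
    show (w.mult : ℝ) * (((if w = w then (1 : ℝ≥0) else 0) : ℝ≥0) : ℝ) = w.mult
    rw [if_pos rfl, NNReal.coe_one, mul_one]
  · intro w' _ hw'
    rw [EffArithDivisor.toArithDivisor_snd]
    show (w'.mult : ℝ) * (((if w' = w then (1 : ℝ≥0) else 0) : ℝ≥0) : ℝ) = 0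
    rw [if_neg hw', NNReal.coe_zero, mul_zero]
  · intro h
    exact absurd (Finset.mem_univ w) h

/-- **The non-negative cone of `(Pic_Φ(A), δ_A)` IS the set of classes of `Φ(L)^rlf`**, `L = Base A` — the 'order
structure' of Thm. 6.4 (ii)'s proof; the `hcone`/`hmon` input of abc-iut-w4-d086's `Thm64ii_L02_orderCompat_of_cones`
/ `_of_monoidIso` at THE realified arithmetic Frobenioids. [cite: MochizukiFrdI2008, Thm. 6.4 (ii) p.115] -/
theorem arithRealification_δ_nonneg_iff (x : (arithRealification hΦ).Pic A) :
    0 ≤ (arithRealification hΦ).δ A hA x ↔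
      ∃ a : (PreFrobenioid.IsPerfFactorialOn.op hΦ (op A.base)).Rlf,
        x = Additive.ofMul (QuotientGroup.mk' _ (Algebra.GrothendieckGroup.of a)) := by
  have h := ArithRlfPic.arith_picDegree_nonneg_iff hΦ A.base (ArithRlfPic.rlfDegree hΦ A.base)
    (ArithRlfPic.rlfDegree_iota hΦ A.base) (ArithRlfPic.picDegree hΦ A.base) (ArithRlfPic.picDegree_comp_mk' hΦ A.base)
    (Additive.toMul x)
  exact h

/-- The same with effective ARITHMETIC divisors: `0 ≤ δ_A x ↔ x = [ι D]` for some `D ∈ Φ(L)`.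
[cite: MochizukiFrdI2008, Thm. 6.4 (i) p.115] -/
theorem arithRealification_δ_nonneg_iff_iota (x : (arithRealification hΦ).Pic A) :
    0 ≤ (arithRealification hΦ).δ A hA x ↔
      ∃ D : EffArithDivisor A.base.L, x = Additive.ofMul (QuotientGroup.mk' _ (Algebra.GrothendieckGroup.of
        ((PreFrobenioid.IsPerfFactorialOn.op hΦ (op A.base)).toRealification
          (Perfection.of _ (Multiplicative.ofAdd D))))) := by
  have h := ArithRlfPic.arith_picDegree_nonneg_iff_iota hΦ A.base (ArithRlfPic.rlfDegree hΦ A.base)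
    (ArithRlfPic.rlfDegree_iota hΦ A.base) (ArithRlfPic.picDegree hΦ A.base) (ArithRlfPic.picDegree_comp_mk' hΦ A.base)
    (Additive.toMul x)
  exact h

variable (B : PreFrobenioid.rlf (ModelFrobenioid.toElem (arithDivisorFunctor F K) (unitsFunctor F K) (divNatTrans F K)) hΦ)
  (hB : (arithRealification hΦ).ops.IsFrobeniusTrivial B)

/-- **`δ_A (Pic(f) x) = [L_A : L_B] · δ_B x`** for a morphism `f : Base A ⟶ Base B` of the base (a field embedding
`L_B → L_A`): the descended degrees scale by the degree of the extension along abc-iut-L1-t5's `picPull` — so along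
chains of base morphisms `δ` is natural up to the positive factors `[L_A : L_B]`, the bookkeeping behind ONE
`deg(Ψ^rlf)` over the connected base (T64ii/L04, scaled form). [cite: MochizukiFrdI2008, Thm. 6.4 (ii) p.114] -/
theorem arithRealification_δ_picPull (f : A.base ⟶ B.base) (x : (arithRealification hΦ).Pic B) :
    (arithRealification hΦ).δ A hA (Additive.ofMul
      (((RealificationData.canonical (arithDivisorFunctor F K) (PreFrobenioid.IsPerfFactorialOn.op hΦ)).realSpan
        (PreFrobenioid.biratSubfunctor
          (ModelFrobenioid.toElem (arithDivisorFunctor F K) (unitsFunctor F K) (divNatTrans F K)))).picPull f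
        (Additive.toMul x))) =
      (letI := f.toAlgHom.toRingHom.toAlgebra; Module.finrank B.base.L A.base.L) * (arithRealification hΦ).δ B hB x :=
  ArithRlfPic.arith_toAdd_picDegree_picPull hΦ f (ArithRlfPic.rlfDegree hΦ A.base) (ArithRlfPic.rlfDegree_iota hΦ A.base)
    (ArithRlfPic.rlfDegree hΦ B.base) (ArithRlfPic.rlfDegree_iota hΦ B.base) (ArithRlfPic.picDegree hΦ A.base)
    (ArithRlfPic.picDegree_comp_mk' hΦ A.base) (ArithRlfPic.picDegree hΦ B.base) (ArithRlfPic.picDegree_comp_mk' hΦ B.base)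
    (Additive.toMul x)

/-- `[L_X : L_Y] ≥ 1` along a morphism `f : X ⟶ Y` of `D = FinSubextCat F K` (tower law, abc-iut-L1-t12's
`FinSubextCat.finrank_eq_finrank_mul_finrank_along`). [cite: MochizukiFrdI2008, Ex. 6.3 p.113] -/
theorem FinSubextCat.finrank_along_pos {X Y : FinSubextCat F K} (f : X ⟶ Y) :
    0 < (letI := f.toAlgHom.toRingHom.toAlgebra; Module.finrank Y.L X.L) := by
  have h := FinSubextCat.finrank_eq_finrank_mul_finrank_along f
  have hX : 0 < Module.finrank F X.L := Module.finrank_pos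
  rcases Nat.eq_zero_or_pos (letI := f.toAlgHom.toRingHom.toAlgebra; Module.finrank Y.L X.L) with h0 | hpos
  · exfalso
    rw [h0, mul_zero] at h
    exact hX.ne' h
  · exact hpos

/-- **`Pic(f) : Pic_Φ(Base B) → Pic_Φ(Base A)` is BIJECTIVE** for every base morphism `f : Base A ⟶ Base B` of THE
realified arithmetic Frobenioid: `δ_A ∘ Pic(f) = [L_A : L_B] · δ_B` with both `δ`'s bijective and `[L_A : L_B] ≥ 1`.
(So the `Pic_Φ` of objects over comparable base objects are ISOMORPHIC by transports scaling `δ` by a natural number —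
the `τ`'s of the scaled-naturality form of T64ii/L04.) [cite: MochizukiFrdI2008, Thm. 6.4 (ii) p.114] -/
theorem arithRealification_picPull_bijective (f : A.base ⟶ B.base) :
    Bijective (((RealificationData.canonical (arithDivisorFunctor F K) (PreFrobenioid.IsPerfFactorialOn.op hΦ)).realSpan
      (PreFrobenioid.biratSubfunctor
        (ModelFrobenioid.toElem (arithDivisorFunctor F K) (unitsFunctor F K) (divNatTrans F K)))).picPull f) := by
  have hc : 0 < (letI := f.toAlgHom.toRingHom.toAlgebra; Module.finrank B.base.L A.base.L) :=
    FinSubextCat.finrank_along_pos f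
  have hc' : ((letI := f.toAlgHom.toRingHom.toAlgebra; Module.finrank B.base.L A.base.L) : ℝ) ≠ 0 := by
    exact_mod_cast hc.ne'
  have hscale := fun x => ArithRlfPic.arith_toAdd_picDegree_picPull hΦ f (ArithRlfPic.rlfDegree hΦ A.base)
    (ArithRlfPic.rlfDegree_iota hΦ A.base) (ArithRlfPic.rlfDegree hΦ B.base) (ArithRlfPic.rlfDegree_iota hΦ B.base)
    (ArithRlfPic.picDegree hΦ A.base) (ArithRlfPic.picDegree_comp_mk' hΦ A.base) (ArithRlfPic.picDegree hΦ B.base)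
    (ArithRlfPic.picDegree_comp_mk' hΦ B.base) x
  constructor
  · intro x y hxy
    apply (ArithRlfPic.picDegree_bijective hΦ B.base).1
    apply Multiplicative.toAdd.injective
    have h := congrArg (fun z => Multiplicative.toAdd (ArithRlfPic.picDegree hΦ A.base z)) hxy
    beta_reduce at h
    rw [hscale, hscale] at h
    exact mul_left_cancel₀ hc' h
  · intro z
    obtain ⟨y, hy⟩ := (ArithRlfPic.picDegree_bijective hΦ B.base).2
      (Multiplicative.ofAdd (Multiplicative.toAdd (ArithRlfPic.picDegree hΦ A.base z) /
        (letI := f.toAlgHom.toRingHom.toAlgebra; Module.finrank B.base.L A.base.L)))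
    refine ⟨y, (ArithRlfPic.picDegree_bijective hΦ A.base).1 ?_⟩
    apply Multiplicative.toAdd.injective
    rw [hscale, hy, toAdd_ofAdd, mul_div_cancel₀ _ hc']

end InstanceDelta

end Literature.AlgebraicGeometry.Frobenioids

end
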